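import Literature.NumberTheory.EllipticCurves.ShafarevichGoodReduction
import Literature.NumberTheory.DiophantineGeometry.SiegelIntegralPoints
import Literature.NumberTheory.DiophantineGeometry.SiegelIntegralPointsReduction
import Literature.NumberTheory.DiophantineGeometry.SiegelCubicReduction
import Literature.NumberTheory.DiophantineGeometry.UnitEquationFinite
import Literature.NumberTheory.EllipticCurves.KummerSelmerGroupFinite
import Literature.NumberTheory.DiophantineGeometry.LocalReductionProofs
import Literature.NumberTheory.DiophantineGeometry.LocalReductionHasMultiplicativeReductionAtProofs
import Mathlib.RingTheory.DedekindDomain.SInteger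
import HarnessLib

/-!
# Shafarevich's theorem from Siegel's theorem (proofs)

Topic: elliptic curves over number fields — reduction types at finite places
(`Literature.NumberTheory.DiophantineGeometry.LocalReduction`: `W.HasGoodReductionAt v`,
`W.badPlaces A`). This theorem-only file discharges the named fact
`WeierstrassCurve.shafarevich_finite_goodReductionOutside K` of
`Literature.NumberTheory.EllipticCurves.ShafarevichGoodReduction` (Silverman, *AEC*, 2nd ed.,
Thm. IX.6.1, Shafarevich: up to `K`-isomorphism only finitely many elliptic curves over a number
field `K` have good reduction outside a finite set `S` of places). The reduction proved here is
to **Siegel's theorem**, in the precise form in which the printed proof invokes it: finiteness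
of the `S`-integral points of the Mordell curves `Y² = X³ + D`, `D ≠ 0` (*AEC* Cor. IX.3.2.1,
the named fact
`WeierstrassCurve.siegel_finite_integralPoints` of
`Literature.NumberTheory.DiophantineGeometry.SiegelIntegralPoints`, corollary
`finite_setOf_sq_eq_cube_add_of_siegel`). The other arithmetic input of the printed proof, the
finiteness of `R_S^*/(R_S^*)^{12}`, is replaced by the finiteness of
`K(S, 12) ⊆ Kˣ/(Kˣ)¹²` (*AEC* Prop. VIII.1.6), which is the tree's **theorem**
`NumberField.finite_selmerGroup` (`KummerSelmerGroupFinite`); this makes the printed reduction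
to `S`-minimal Weierstrass equations over a principal `R_S` (*AEC* VIII.8.7, "enlarging `S`" so
that `R_S` has class number one) unnecessary.

Main results (all sorry-free):

* `WeierstrassCurve.exists_valuation_eq_pow_of_hasGoodReductionAt`: if `W/K` has good
  reduction at `v`, then for some `u ∈ Kˣ`, `v(Δ_W) = v(u)¹²`, `v(c₄(W)) ≤ v(u)⁴`,
  `v(c₆(W)) ≤ v(u)⁶` (a `v`-minimal model `C • W` over the valuation ring of `v` in `K` has unit
  discriminant and integral `c₄, c₆`; `Δ, c₄, c₆` scale by `u⁻¹², u⁻⁴, u⁻⁶`).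
* `WeierstrassCurve.twelve_dvd_log_valuation_Δ_of_hasGoodReductionAt`: hence `12 ∣ ord_v(Δ_W)`,
  and `valuation_c₄_le_one_of_hasGoodReductionAt` / `…c₆…`: if moreover `v(Δ_W) ≤ 1` then
  `c₄(W), c₆(W)` are `v`-integral.
* `WeierstrassCurve.exists_variableChange_eq_c₄_c₆`: in characteristic zero every Weierstrass
  curve `V` is `K`-isomorphic to `y² = x³ - 27 c₄(V) x - 54 c₆(V)` (explicit change of
  variables with `u = 1/6`; Silverman, *AEC*, III.§1, PDF p. 49).
* `WeierstrassCurve.exists_finset_variableChange_of_badPlaces_subset_of_finite_mordell`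
  (**Thm. IX.6.1 for a given finite `S`**, from the finiteness `hM` of the `S`-integral points of
  all Mordell curves `y² = x³ + D`, `D ∈ Kˣ`) and
  `WeierstrassCurve.shafarevich_finite_goodReductionOutside_of_finite_mordell`
  (`hM` for all finite `S` ⇒ the named fact `shafarevich_finite_goodReductionOutside K`).
* `WeierstrassCurve.shafarevich_finite_goodReductionOutside_of_siegel`: the named fact
  `shafarevich_finite_goodReductionOutside K` (*AEC* Thm. IX.6.1) from the named fact
  `siegel_finite_integralPoints K` (*AEC* Cor. IX.3.2.1) alone.
* `WeierstrassCurve.shafarevich_finite_goodReductionOutside_holds` (**the discharge**,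
  unconditional): `_of_siegel` fed with Siegel's theorem assembled along *AEC* IX.§4 (Siegel's
  second proof, via the unit equation rather than Roth's theorem) from the tree's theorems
  `WeierstrassCurve.siegel_finite_integralPoints_of_cubic` (Cor. IX.4.3.1, reduction to
  `y² = (x - e₁)(x - e₂)(x - e₃)` over `K(E[2])`, `SiegelIntegralPointsReduction`),
  `Literature.NumberTheory.DiophantineGeometry.finite_integer_sq_eq_cubic_of_unitEquation`
  (Thm. IX.4.3, Siegel's reduction to the unit equation, `SiegelCubicReduction`) and
  `Literature.NumberTheory.DiophantineGeometry.finite_unitEquation` (Thm. IX.4.1, finiteness of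
  `u + v = 1` in `T`-units, proved after Beukers–Schlickewei / Bombieri–Gubler Thm. 5.2.1,
  `UnitEquationFinite`).

## The proof (Silverman, *AEC*, 2nd ed., proof of Thm. IX.6.1, PDF pp. 251–252, adapted)

Printed: for `E` with good reduction outside `S ∋ v ∣ 6`, `R_S` principal, take
`y² = x³ + Ax + B` with `A, B ∈ R_S`, `Δ = -16(4A³ + 27B²) ∈ R_S^*`; write `Δ = C D¹²` with `C`
in a finite set of representatives of `R_S^*/(R_S^*)^{12}`; then `(-12A/D⁴, 72B/D⁶)` is an
`S`-integral point on `Y² = X³ + 27C`, a finite set by Siegel (IX.3.2.1), and equal points give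
`K`-isomorphic curves. Here: for `W` elliptic with `badPlaces W ⊆ S`,
(1) `12 ∣ ord_v(Δ_W)` for `v ∉ S`, so the class of `Δ_W` lies in the finite group `K(S, 12)`
(`IsDedekindDomain.mk_mem_selmerGroup_iff`, `NumberField.finite_selmerGroup`); fix nonzero
integral representatives `c_s ∈ 𝓞 K` of its classes (`IsDedekindDomain.exists_mk_eq_of_pos`),
so `Δ_W = c d¹²` with `c = c_s`, `d ∈ Kˣ`;
(2) `W₁ := ⟨d, 0, 0, 0⟩ • W` has `Δ_{W₁} = c`, still good reduction outside `S`
(`badPlaces_smul_holds`), and `v(c) ≤ 1`, so `X := c₄(W₁)`, `Y := c₆(W₁)` are `S`-integers with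
`Y² = X³ - 1728 c` (`WeierstrassCurve.c_relation`) — an `S`-integral point on the Mordell curve
with `D = -1728 c`, of which there are finitely many (`hM`);
(3) `W ≅_K W₁ ≅_K (y² = x³ - 27X x - 54Y)`, which lies in the finite set
`F := ⋃_s {y² = x³ - 27X x - 54Y : (X, Y) ∈ Sol_s}`.

## References

* [SilvermanAEC2009] J. H. Silverman, *The Arithmetic of Elliptic Curves*, 2nd ed., GTM 106,
  Springer 2009, Thm. IX.6.1 (with its proof, PDF pp. 251–252), Cor. IX.3.2.1 (PDF p. 237),
  Prop. VIII.1.6, III.§1 and Table 3.1 (PDF pp. 49–50), VII.1 Prop. 1.3 (PDF p. 166) and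
  Rem. 1.1, VII.5 Prop. 5.1(a).
* I. R. Šafarevič, *Algebraic number fields*, Proc. ICM Stockholm 1962, 163–176.
* [SilvermanAEC2009] *ibid.*, IX.§4 (PDF pp. 241–245): Thm. IX.4.1 (p. 242), Thm. IX.4.3
  (p. 243), Cor. IX.4.3.1 (p. 245) — Siegel's second proof of Cor. IX.3.2.1 ("In this section we
  describe Siegel's alternative proof", p. 242), the route by which the discharge obtains it.
* [BombieriGubler2006] E. Bombieri, W. Gubler, *Heights in Diophantine Geometry*, CUP 2006,
  Thm. 5.2.1 (the unit equation, after Beukers–Schlickewei).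
-/

noncomputable section

open IsDedekindDomain NumberField

universe u

namespace WeierstrassCurve

section Local

variable {A : Type*} [CommRing A] [IsDedekindDomain A] {K : Type*} [Field K]
  [Algebra A K] [IsFractionRing A K] {v : HeightOneSpectrum A} {W : WeierstrassCurve K}

/-- **Good reduction controls `ord_v` of `Δ, c₄, c₆` of any model.** Let `W` be a
Weierstrass curve over the fraction field `K` of a Dedekind domain with good reduction at the
finite place `v`. Then there is `u ∈ Kˣ` with `v(Δ_W) = v(u)¹²`, `v(c₄(W)) ≤ v(u)⁴` and
`v(c₆(W)) ≤ v(u)⁶` (multiplicative valuations). Proof: a minimal equation `C • W` at `v` over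
the valuation ring of `v` in `K` (Mathlib's `exists_isMinimal`; minimal at `v` in the sense of
the completion by `isMinimalAt_iff_isMinimal_integer_holds`) has `v(Δ) = 1` because `W`, hence
`C • W`, has good reduction at `v` (any two minimal equations have discriminants of the same
valuation, `valuation_Δ_smul_eq_of_isMinimal`), and integral `c₄, c₆`; and
`Δ(C • W) = u⁻¹² Δ_W`, `c₄(C • W) = u⁻⁴ c₄(W)`, `c₆(C • W) = u⁻⁶ c₆(W)` for `u = C.u`.
Silverman, *AEC*, 2nd ed., VII.1, Prop. 1.3 (PDF p. 166) and Rem. 1.1, III.§1 Table 3.1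
(PDF p. 50: `u⁴c₄' = c₄`, `u⁶c₆' = c₆`, `u¹²Δ' = Δ`), VII.5 Prop. 5.1(a).
[cite: SilvermanAEC2009, VII.1 Prop. 1.3 and VII.5 Prop. 5.1(a)] -/
theorem exists_valuation_eq_pow_of_hasGoodReductionAt (h : W.HasGoodReductionAt v) :
    ∃ u : Kˣ, v.valuation K W.Δ = v.valuation K (u : K) ^ 12 ∧
      v.valuation K W.c₄ ≤ v.valuation K (u : K) ^ 4 ∧
      v.valuation K W.c₆ ≤ v.valuation K (u : K) ^ 6 := by
  set R := (v.valuation K).integer with hR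
  obtain ⟨C, hC⟩ := exists_isMinimal R W
  have hminAt : (C • W).IsMinimalAt v :=
    Iff.mpr (isMinimalAt_iff_isMinimal_integer_holds v (C • W)) hC
  have hgood : (C • W).HasGoodReductionAt v := (hasGoodReductionAt_smul_iff_holds v W C).mpr h
  -- the discriminant of the `v`-minimal model `C • W` is a `v`-adic unit
  have hΔ1 : v.valuation K (C • W).Δ = 1 := by
    set O := v.adicCompletionIntegers K with hO
    set X := (C • W).baseChange (v.adicCompletion K) with hX
    obtain ⟨E, hE⟩ : ∃ E : VariableChange (v.adicCompletion K),
        (C • W).localMinimalModel v = E • X := ⟨_, rfl⟩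
    haveI hXmin : X.IsMinimal O := hminAt
    haveI hEX : (E • X).IsMinimal O := hE ▸ (instIsMinimalLocalMinimalModel v (C • W))
    have h1 := hgood.goodReduction
    rw [hE, valuation_Δ_smul_eq_of_isMinimal O X E, hX, WeierstrassCurve.baseChange, map_Δ] at h1
    exact (valuation_maximalIdeal_adicCompletion_eq_one_iff v (C • W).Δ).mp h1
  -- the coefficients `c₄, c₆` of the integral model `C • W` are `v`-integral
  have hc₄ : v.valuation K (C • W).c₄ ≤ 1 := by
    rw [← integralModel_c₄_eq R (C • W)]
    exact ((integralModel R (C • W)).c₄).2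
  have hc₆ : v.valuation K (C • W).c₆ ≤ 1 := by
    rw [← integralModel_c₆_eq R (C • W)]
    exact ((integralModel R (C • W)).c₆).2
  have hu0 : v.valuation K (C.u : K) ≠ 0 := (Valuation.ne_zero_iff _).mpr C.u.ne_zero
  have hu : v.valuation K ((C.u⁻¹ : Kˣ) : K) = (v.valuation K (C.u : K))⁻¹ := by
    rw [Units.val_inv_eq_inv_val, map_inv₀]
  refine ⟨C.u, ?_, ?_, ?_⟩
  · rw [variableChange_Δ, map_mul, map_pow, hu, inv_pow] at hΔ1
    exact ((inv_mul_eq_one₀ (pow_ne_zero _ hu0)).mp hΔ1).symm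
  · rw [variableChange_c₄, map_mul, map_pow, hu, inv_pow] at hc₄
    have hpos : 0 < v.valuation K (C.u : K) ^ 4 := pow_pos (zero_lt_iff.mpr hu0) _
    simpa only [mul_one] using (inv_mul_le_iff₀ hpos).mp hc₄
  · rw [variableChange_c₆, map_mul, map_pow, hu, inv_pow] at hc₆
    have hpos : 0 < v.valuation K (C.u : K) ^ 6 := pow_pos (zero_lt_iff.mpr hu0) _
    simpa only [mul_one] using (inv_mul_le_iff₀ hpos).mp hc₆

/-- If `W/K` has good reduction at `v`, then `12 ∣ ord_v(Δ_W)` for *any* Weierstrass model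
`W` (the minimal discriminant at `v` is a unit and `Δ_W = u¹² Δ_min`). Silverman, *AEC*,
2nd ed., VII.1 Prop. 1.3 and proof of Thm. IX.6.1 ("`ord_v(𝒟_{E/K}) = 0` for all `v ∉ S`").
[cite: SilvermanAEC2009, VII.1 Prop. 1.3] -/
theorem twelve_dvd_log_valuation_Δ_of_hasGoodReductionAt (h : W.HasGoodReductionAt v) :
    (12 : ℤ) ∣ WithZero.log (v.valuation K W.Δ) := by
  obtain ⟨u, hu, -, -⟩ := exists_valuation_eq_pow_of_hasGoodReductionAt h
  rw [hu, WithZero.log_pow, nsmul_eq_mul]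
  exact dvd_mul_right _ _

/-- If `W/K` has good reduction at `v` and `v(Δ_W) ≤ 1`, then `c₄(W)` is `v`-integral
(`v(Δ_W) = v(u)¹² ≤ 1` forces `v(u) ≤ 1`, and `v(c₄(W)) ≤ v(u)⁴`). Silverman, *AEC*, 2nd ed.,
VII.1 Prop. 1.3. [cite: SilvermanAEC2009, VII.1 Prop. 1.3] -/
theorem valuation_c₄_le_one_of_hasGoodReductionAt (h : W.HasGoodReductionAt v)
    (hΔ : v.valuation K W.Δ ≤ 1) : v.valuation K W.c₄ ≤ 1 := by
  obtain ⟨u, hu, h₄, -⟩ := exists_valuation_eq_pow_of_hasGoodReductionAt h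
  rw [hu] at hΔ
  have hu1 : v.valuation K (u : K) ≤ 1 := (pow_le_one_iff (by norm_num)).mp hΔ
  exact h₄.trans (pow_le_one' hu1 _)

/-- If `W/K` has good reduction at `v` and `v(Δ_W) ≤ 1`, then `c₆(W)` is `v`-integral
(`v(Δ_W) = v(u)¹² ≤ 1` forces `v(u) ≤ 1`, and `v(c₆(W)) ≤ v(u)⁶`). Silverman, *AEC*, 2nd ed.,
VII.1 Prop. 1.3. [cite: SilvermanAEC2009, VII.1 Prop. 1.3] -/
theorem valuation_c₆_le_one_of_hasGoodReductionAt (h : W.HasGoodReductionAt v)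
    (hΔ : v.valuation K W.Δ ≤ 1) : v.valuation K W.c₆ ≤ 1 := by
  obtain ⟨u, hu, -, h₆⟩ := exists_valuation_eq_pow_of_hasGoodReductionAt h
  rw [hu] at hΔ
  have hu1 : v.valuation K (u : K) ≤ 1 := (pow_le_one_iff (by norm_num)).mp hΔ
  exact h₆.trans (pow_le_one' hu1 _)

end Local

section ShortModel

variable {K : Type*} [Field K] [CharZero K]

/-- **The model `y² = x³ - 27c₄x - 54c₆`.** Over a field of characteristic zero every
Weierstrass curve `V` is carried by an admissible change of variables (with `u = 1/6`,
`r = -b₂/12`, `s = -a₁/2`, `t = -(a₃ + r a₁)/2`) to `y² = x³ - 27 c₄(V) x - 54 c₆(V)`.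
Silverman, *AEC*, 2nd ed., III.§1, PDF p. 49 ("`E : y² = x³ - 27c₄x - 54c₆`", for
`char ≠ 2, 3`). [cite: SilvermanAEC2009, III.§1 (PDF p. 49)] -/
theorem exists_variableChange_eq_c₄_c₆ (V : WeierstrassCurve K) :
    ∃ C : VariableChange K, C • V = ⟨0, 0, 0, -27 * V.c₄, -54 * V.c₆⟩ := by
  refine ⟨⟨Units.mk0 6⁻¹ (by norm_num), -V.b₂ / 12, -V.a₁ / 2,
    -(V.a₃ - V.b₂ / 12 * V.a₁) / 2⟩, ?_⟩
  ext
  · simp only [variableChange_a₁]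
    field_simp
    ring
  · simp only [variableChange_a₂, b₂]
    field_simp
    ring
  · simp only [variableChange_a₃, b₂]
    field_simp
    ring
  · simp only [variableChange_a₄, b₂, c₄, b₄, Units.val_inv_eq_inv_val, Units.val_mk0, inv_inv]
    field_simp
    ring
  · simp only [variableChange_a₆, b₂, c₆, b₄, b₆, Units.val_inv_eq_inv_val, Units.val_mk0, inv_inv]
    field_simp
    ring

end ShortModel

section Global

variable {K : Type u} [Field K]

/-- **Shafarevich's theorem (Silverman, *AEC*, Thm. IX.6.1) for a given `S`, from Siegel's
theorem for Mordell curves.** Let `K` be a number field and `S` a finite set of finite places of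
`K`, and assume (`hM`) that for every `D ∈ Kˣ` the equation `y² = x³ + D` has only finitely
many solutions `x, y ∈ K` with `x` an `S`-integer (Siegel, *AEC* Cor. IX.3.2.1 — the named fact
`WeierstrassCurve.siegel_finite_integralPoints`, via `finite_setOf_sq_eq_cube_add_of_siegel`).
Then there is a finite set `F` of Weierstrass models over `K` such that every elliptic `W/K`
whose places of bad reduction lie in `S` satisfies `C • W ∈ F` for some admissible change of
variables `C` over `K`. Proof: see the module docstring — `12 ∣ ord_v(Δ_W)` off `S` puts the
class of `Δ_W` in the finite group `K(S, 12)` (`NumberField.finite_selmerGroup`, replacing the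
printed `R_S^*/(R_S^*)^{12}`); rescaling by `d` with `Δ_W = c d¹²` (`c` a fixed integral
representative) gives a model `W₁` with `Δ = c` whose `c₄, c₆` are `S`-integral, i.e. an
`S`-integral point `(c₄, c₆)` on `Y² = X³ - 1728c`; and `W ≅_K (y² = x³ - 27c₄ x - 54c₆)`.
[cite: SilvermanAEC2009, Thm. IX.6.1 (proof)] -/
theorem exists_finset_variableChange_of_badPlaces_subset_of_finite_mordell [NumberField K]
    {S : Set (HeightOneSpectrum (𝓞 K))} (hS : S.Finite)
    (hM : ∀ D : K, D ≠ 0 → {p : K × K | p.2 ^ 2 = p.1 ^ 3 + D ∧ p.1 ∈ S.integer K}.Finite) :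
    ∃ F : Finset (WeierstrassCurve K), ∀ (W : WeierstrassCurve K) [W.IsElliptic],
      W.badPlaces (𝓞 K) ⊆ S → ∃ C : VariableChange K, C • W ∈ F := by
  classical
  -- the finite group `K(S, 12)` and nonzero integral representatives of its classes
  haveI : Finite (selmerGroup (R := 𝓞 K) (K := K) (S := S) (n := 12)) :=
    NumberField.finite_selmerGroup K hS (by norm_num)
  have hrep : ∀ s : selmerGroup (R := 𝓞 K) (K := K) (S := S) (n := 12),
      ∃ (r : 𝓞 K) (x : Kˣ), r ≠ 0 ∧ (x : K) = algebraMap (𝓞 K) K r ∧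
        (QuotientGroup.mk x : Kˣ ⧸ (powMonoidHom 12 : Kˣ →* Kˣ).range) = s := fun s ↦
    IsDedekindDomain.exists_mk_eq_of_pos (by norm_num) _
  choose rint rep hrint hrep_eq hrep_mk using hrep
  -- Siegel: finitely many `S`-integral points on each Mordell curve `y² = x³ - 1728 c_s`
  let Sol : selmerGroup (R := 𝓞 K) (K := K) (S := S) (n := 12) → Set (K × K) := fun s ↦
    {p | p.2 ^ 2 = p.1 ^ 3 + -1728 * (rep s : K) ∧ p.1 ∈ S.integer K}
  have hSol : ∀ s, (Sol s).Finite := fun s ↦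
    hM (-1728 * (rep s : K)) (mul_ne_zero (by norm_num) (rep s).ne_zero)
  let g : K × K → WeierstrassCurve K := fun p ↦ ⟨0, 0, 0, -27 * p.1, -54 * p.2⟩
  have hF : (⋃ s, g '' Sol s).Finite := Set.finite_iUnion fun s ↦ (hSol s).image g
  refine ⟨hF.toFinset, fun W _ hbad ↦ ?_⟩
  have hΔ0 : W.Δ ≠ 0 := W.coe_Δ' ▸ W.Δ'.ne_zero
  have hgood : ∀ v ∉ S, W.HasGoodReductionAt v := fun v hv ↦
    by_contra fun h ↦ hv (hbad h)
  -- the class of `Δ(W)` modulo 12th powers lies in `K(S, 12)`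
  have hmem : (QuotientGroup.mk (Units.mk0 W.Δ hΔ0) : Kˣ ⧸ (powMonoidHom 12 : Kˣ →* Kˣ).range) ∈
      selmerGroup (R := 𝓞 K) (K := K) (S := S) (n := 12) := by
    rw [IsDedekindDomain.mk_mem_selmerGroup_iff]
    intro v hv
    rw [Units.val_mk0]
    exact_mod_cast twelve_dvd_log_valuation_Δ_of_hasGoodReductionAt (hgood v hv)
  set s₀ : selmerGroup (R := 𝓞 K) (K := K) (S := S) (n := 12) := ⟨_, hmem⟩ with hs₀
  -- `Δ(W) = c · d¹²` with `c = rep s₀`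
  obtain ⟨d, hd⟩ : ∃ d : Kˣ, d ^ 12 = (rep s₀)⁻¹ * Units.mk0 W.Δ hΔ0 := by
    obtain ⟨d, hd⟩ := MonoidHom.mem_range.mp (QuotientGroup.eq.mp (hrep_mk s₀))
    exact ⟨d, hd⟩
  have hd' : ((d : Kˣ) : K) ^ 12 = ((rep s₀ : Kˣ) : K)⁻¹ * W.Δ := by
    have := congrArg Units.val hd
    simpa only [Units.val_pow_eq_pow_val, Units.val_mul, Units.val_inv_eq_inv_val,
      Units.val_mk0] using this
  -- rescale: `W₁ = ⟨d, 0, 0, 0⟩ • W` has discriminant `c`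
  set Cd : VariableChange K := ⟨d, 0, 0, 0⟩ with hCd
  set W₁ := Cd • W with hW₁
  have hΔ₁ : W₁.Δ = (rep s₀ : K) := by
    rw [hW₁, variableChange_Δ, hCd]
    simp only
    rw [Units.val_inv_eq_inv_val, inv_pow, hd', mul_inv, inv_inv,
      mul_assoc, inv_mul_cancel₀ hΔ0, mul_one]
  -- `c₄(W₁), c₆(W₁)` are `S`-integers
  have hgood₁ : ∀ v ∉ S, W₁.HasGoodReductionAt v := by
    intro v hv
    by_contra h
    have h' : v ∈ W₁.badPlaces (𝓞 K) := h
    rw [hW₁, badPlaces_smul_holds (𝓞 K) W Cd] at h'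
    exact hv (hbad h')
  have hΔle : ∀ v ∉ S, v.valuation K W₁.Δ ≤ 1 := fun v _ ↦ by
    rw [hΔ₁, hrep_eq]
    exact v.valuation_le_one _
  have hX : W₁.c₄ ∈ S.integer K := fun v hv ↦
    valuation_c₄_le_one_of_hasGoodReductionAt (hgood₁ v hv) (hΔle v hv)
  have hY : W₁.c₆ ∈ S.integer K := fun v hv ↦
    valuation_c₆_le_one_of_hasGoodReductionAt (hgood₁ v hv) (hΔle v hv)
  have hsol : (W₁.c₄, W₁.c₆) ∈ Sol s₀ := by
    refine ⟨?_, hX⟩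
    have hc := W₁.c_relation
    rw [hΔ₁] at hc
    simp only
    linear_combination hc
  -- the model `y² = x³ - 27 c₄(W₁) x - 54 c₆(W₁)` is `K`-isomorphic to `W`
  obtain ⟨C₁, hC₁⟩ := exists_variableChange_eq_c₄_c₆ W₁
  refine ⟨C₁ * Cd, ?_⟩
  rw [Set.Finite.mem_toFinset, mul_smul, ← hW₁, hC₁]
  exact Set.mem_iUnion.mpr ⟨s₀, (W₁.c₄, W₁.c₆), hsol, rfl⟩

variable (K) in
/-- **Shafarevich's theorem from Siegel's theorem for Mordell curves**: if for every finite
set `S` of finite places of the number field `K` and every `D ∈ Kˣ` the Mordell equation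
`y² = x³ + D` has only finitely many solutions `x, y ∈ K` with `x ∈ R_S` (a consequence of the
named fact `WeierstrassCurve.siegel_finite_integralPoints K`, *AEC* Cor. IX.3.2.1), then the
named fact `WeierstrassCurve.shafarevich_finite_goodReductionOutside K` (*AEC* Thm. IX.6.1)
holds. [cite: SilvermanAEC2009, Thm. IX.6.1 (proof)] -/
theorem shafarevich_finite_goodReductionOutside_of_finite_mordell
    (hM : ∀ [NumberField K] (S : Set (HeightOneSpectrum (𝓞 K))), S.Finite →
      ∀ D : K, D ≠ 0 → {p : K × K | p.2 ^ 2 = p.1 ^ 3 + D ∧ p.1 ∈ S.integer K}.Finite) :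
    shafarevich_finite_goodReductionOutside K := by
  intro _ S hS
  exact exists_finset_variableChange_of_badPlaces_subset_of_finite_mordell hS (hM S hS)

variable (K) in
/-- **Shafarevich's theorem from Siegel's theorem** (Silverman, *AEC*, 2nd ed., Thm. IX.6.1
from Cor. IX.3.2.1, as in the printed proof, PDF pp. 251–252: "Siegel's theorem (IX.3.2.1)
says that there are only finitely many such points"). The named fact
`siegel_finite_integralPoints K` (finiteness of the `S`-integral points of every elliptic curve
over the number field `K`, for every finite `S`) implies the named fact
`shafarevich_finite_goodReductionOutside K`: by `finite_setOf_sq_eq_cube_add_of_siegel` it gives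
the finiteness of the `S`-integral points of the Mordell curves `y² = x³ + D`, `D ≠ 0`, which is
all that `shafarevich_finite_goodReductionOutside_of_finite_mordell` uses. This is the whole
in-tree reduction of the discharge `shafarevich_finite_goodReductionOutside_holds` to Siegel's
theorem. [cite: SilvermanAEC2009, Thm. IX.6.1 (proof) and Cor. IX.3.2.1] -/
theorem shafarevich_finite_goodReductionOutside_of_siegel (h : siegel_finite_integralPoints K) :
    shafarevich_finite_goodReductionOutside K :=
  shafarevich_finite_goodReductionOutside_of_finite_mordell K fun _ hS _ hD ↦
    finite_setOf_sq_eq_cube_add_of_siegel h hS hD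

variable (K) in
/-- **Shafarevich's theorem** (Silverman, *AEC*, 2nd ed., Thm. IX.6.1; Šafarevič 1962) — the
discharge of the named fact `shafarevich_finite_goodReductionOutside K`: for `K` a number field
and `S` a finite set of finite places of `K` there is a finite set `F` of Weierstrass curves over
`K` such that every elliptic Weierstrass curve over `K` with good reduction at all finite places
outside `S` is taken into `F` by an admissible change of variables over `K` (so up to
`K`-isomorphism only finitely many elliptic curves over `K` have good reduction outside `S`).
Proof: `shafarevich_finite_goodReductionOutside_of_siegel` (the printed proof of Thm. IX.6.1 via
the `S`-integral points of the Mordell curves `Y² = X³ + D`) applied to Siegel's theorem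
Cor. IX.3.2.1, which is obtained unconditionally along Siegel's second proof, *AEC* IX.§4:
Cor. IX.4.3.1 (`siegel_finite_integralPoints_of_cubic`: it suffices to bound the `T`-integral
`x` with `(x - e₁)(x - e₂)(x - e₃)` a square, over the number field `K(E[2])`), Thm. IX.4.3
(`finite_integer_sq_eq_cubic_of_unitEquation`: Siegel's reduction of that hyperelliptic
equation to the unit equation) and Thm. IX.4.1 (`finite_unitEquation`: `u + v = 1` has only
finitely many solutions in `T`-units, after Beukers–Schlickewei / Bombieri–Gubler Thm. 5.2.1).
[cite: SilvermanAEC2009, Thm. IX.6.1] -/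
theorem shafarevich_finite_goodReductionOutside_holds :
    shafarevich_finite_goodReductionOutside K :=
  shafarevich_finite_goodReductionOutside_of_siegel K
    (siegel_finite_integralPoints_of_cubic fun L _ _ T hT e₁ e₂ e₃ h₁₂ h₁₃ h₂₃ ↦
      Literature.NumberTheory.DiophantineGeometry.finite_integer_sq_eq_cubic_of_unitEquation L
        (fun F _ _ T' hT' ↦
          Literature.NumberTheory.DiophantineGeometry.finite_unitEquation F T' hT')
        T hT e₁ e₂ e₃ h₁₂ h₁₃ h₂₃)

end Global

end WeierstrassCurve

end
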